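import Summits.AnomalousDissipation.AnomalousDissipation.Theorems.BaireTransferRobustLoudUpgradeStubLsFamilyPeriodic

/-!
# Line `malkin-cone-group-orbits`, companion c4 ("the viscosity unfolding"): the radial periodic class
# (crux `BaireTransfer.RobustLoudUpgrade`, stmt-AnomalousDissipation-1144), registered stub `stub_radialPeriodic`

Let `u` be a genuinely time-dependent `τ`-periodic classical solution of `NS_ν(f_c)` on `T³`, forced by the steady
trigonometric polynomial `f_c = force S c`, whose linearised periodic problem is SIMPLY degenerate (free-period kernel
`{∂ₜu, v}`), and assume RADIAL VISIBILITY: the forcing itself (plus any multiple of `∂ₜu`) is never in the range of the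
linearised periodic operator, `linPeriodicSol ν u τ (β∂ₜu + f_c) = ∅` for every `β`.  Feeding the border field
`H := f_c` (smooth, trivially `τ`-periodic, divergence free, mean zero) to the landed periodic Lyapunov–Schmidt
family `LsFamilyPeriodic.stub_lsFamilyPeriodic` (companion c3) produces the reduced function
`σ : P_S × ℝ → ℝ` with `σ(c, 0) = 0`, a Fréchet derivative `ℓ` at `(c, 0)` whose visibility test, applied to
`d := c`, reads `ℓ(c, 0) ≠ 0`, and the realisation of the zeros of `σ` as periodic orbits of the UNCORRECTED forces
uniformly `L² ∩ Ḣ¹`-near `u` after time rescaling.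

The registered stub asks for two consequences: the family-at-zeros clause (a projection of the realisation clause)
and a SIGN CHANGE of `σ` along the ray `s ↦ σ(s • c, 0)` at `s = 1`, arbitrarily close to `1`.  The latter is
one-variable calculus: `g(t) := σ((1 + t) • c, 0)` has `g(0) = 0` and `g'(0) = ℓ(c, 0) ≠ 0` (chain rule along the
affine path `t ↦ (c, 0) + t • (c, 0)`), so the difference quotient `g(t)/t → g'(0)` keeps the sign of `g'(0)` on
both one-sided punctured neighbourhoods of `0`, whence `g` takes both signs at points `|t| < η`.

References: Iooss, *Arch. Ration. Mech. Anal.* 47 (1972) §2–3; Henry, *Geometric Theory of Semilinear Parabolic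
Equations* (1981) Thm. 8.3.2; Kielhöfer, *Bifurcation Theory* (2012) §I.8, §I.12 (the fold along a visible
parameter); the skeleton `Cruxes/RobustLoudUpgrade/Lines/malkin-cone-group-orbits_c4.lean`.
-/

-- `Summit.<Summit>.<Problem>` is the tree's mandated summit-side namespace (CONVENTIONS §2); for this
-- single-conjunct summit the two coincide, so the duplicate is deliberate.
set_option linter.dupNamespace false

noncomputable section

open scoped BigOperators Topology
open Filter Set Function TopologicalSpace MeasureTheory

namespace Summit.AnomalousDissipation.AnomalousDissipation.Theorems.RobustLoudUpgrade.ScalingCrossing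

open Literature.Analysis.FunctionSpaces Literature.Analysis.FunctionSpaces.Torus
open Literature.Analysis.FunctionSpaces.EuclideanSpace
open Literature.Analysis.FluidPDE
open Summit.AnomalousDissipation.AnomalousDissipation.Theses.BaireTransfer
open Summit.AnomalousDissipation.AnomalousDissipation.Theorems.RobustLoudUpgrade

/-! ## §1 One-variable calculus: a simple zero is a sign change -/

/-- **A simple zero is a sign change, quantitatively.**  If `g : ℝ → ℝ` has `g 0 = 0` and a NON-ZERO derivative
`m` at `0`, then for every `η > 0` there are `t₁, t₂` with `|tᵢ| < η`, `g t₁ < 0 < g t₂`: the difference quotient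
`t⁻¹ g(t) → m` on `𝓝[>] 0` and on `𝓝[<] 0`, so it eventually has the sign of `m` on both sides, and `g t = t · (t⁻¹ g t)`.
[folklore] -/
theorem exists_sign_change_of_hasDerivAt {g : ℝ → ℝ} {m : ℝ} (hg : HasDerivAt g m 0) (hg0 : g 0 = 0)
    (hm : m ≠ 0) {η : ℝ} (hη : 0 < η) :
    ∃ t₁ t₂ : ℝ, |t₁| < η ∧ |t₂| < η ∧ g t₁ < 0 ∧ 0 < g t₂ := by
  have hR : Tendsto (fun t : ℝ => t⁻¹ * g t) (𝓝[>] 0) (𝓝 m) := by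
    simpa [hg0] using hg.tendsto_slope_zero_right
  have hL : Tendsto (fun t : ℝ => t⁻¹ * g t) (𝓝[<] 0) (𝓝 m) := by
    simpa [hg0] using hg.tendsto_slope_zero_left
  have hIR : ∀ᶠ t in 𝓝[>] (0 : ℝ), t ∈ Set.Ioo 0 η := Ioo_mem_nhdsGT hη
  have hIL : ∀ᶠ t in 𝓝[<] (0 : ℝ), t ∈ Set.Ioo (-η) 0 := Ioo_mem_nhdsLT (neg_lt_zero.2 hη)
  have key : ∀ t : ℝ, t ≠ 0 → g t = t * (t⁻¹ * g t) := fun t ht => (mul_inv_cancel_left₀ ht _).symm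
  rcases lt_or_gt_of_ne hm with hm | hm
  · -- `m < 0`: `g < 0` just right of `0`, `g > 0` just left of `0`
    obtain ⟨t₁, ht₁, ht₁I⟩ := ((hR.eventually_lt_const hm).and hIR).exists
    obtain ⟨t₂, ht₂, ht₂I⟩ := ((hL.eventually_lt_const hm).and hIL).exists
    refine ⟨t₁, t₂, abs_lt.2 ⟨by linarith [ht₁I.1], ht₁I.2⟩, abs_lt.2 ⟨ht₂I.1, by linarith [ht₂I.2]⟩, ?_, ?_⟩
    · rw [key t₁ ht₁I.1.ne']
      exact mul_neg_of_pos_of_neg ht₁I.1 ht₁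
    · rw [key t₂ ht₂I.2.ne]
      exact mul_pos_of_neg_of_neg ht₂I.2 ht₂
  · -- `0 < m`: `g < 0` just left of `0`, `g > 0` just right of `0`
    obtain ⟨t₁, ht₁, ht₁I⟩ := ((hL.eventually_const_lt hm).and hIL).exists
    obtain ⟨t₂, ht₂, ht₂I⟩ := ((hR.eventually_const_lt hm).and hIR).exists
    refine ⟨t₁, t₂, abs_lt.2 ⟨ht₁I.1, by linarith [ht₁I.2]⟩, abs_lt.2 ⟨by linarith [ht₂I.1], ht₂I.2⟩, ?_, ?_⟩
    · rw [key t₁ ht₁I.2.ne]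
      exact mul_neg_of_neg_of_pos ht₁I.2 ht₁
    · rw [key t₂ ht₂I.1.ne']
      exact mul_pos ht₂I.1 ht₂

/-- **Chain rule along the ray.**  If `σ : P × ℝ → ℝ` has Fréchet derivative `ℓ` at `(c, 0)`, then
`t ↦ σ((1 + t) • c, 0)` has derivative `ℓ(c, 0)` at `t = 0` (the affine path `t ↦ (c, 0) + t • (c, 0)` has velocity
`(c, 0)`). [folklore] -/
theorem hasDerivAt_along_ray {P : Type*} [NormedAddCommGroup P] [NormedSpace ℝ P] {σ : P × ℝ → ℝ}
    {ℓ : P × ℝ →L[ℝ] ℝ} {c : P} (hσ : HasFDerivAt σ ℓ (c, 0)) :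
    HasDerivAt (fun t : ℝ => σ ((1 + t) • c, 0)) (ℓ (c, 0)) 0 := by
  have hγ : HasDerivAt (fun t : ℝ => (c, (0 : ℝ)) + t • (c, (0 : ℝ))) (c, (0 : ℝ)) 0 := by
    simpa using ((hasDerivAt_id (0 : ℝ)).smul_const (c, (0 : ℝ))).const_add (c, (0 : ℝ))
  have hcomp : HasDerivAt (σ ∘ fun t : ℝ => (c, (0 : ℝ)) + t • (c, (0 : ℝ))) (ℓ (c, (0 : ℝ))) 0 :=
    hσ.comp_hasDerivAt_of_eq (0 : ℝ) hγ (by simp)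
  have heq : (σ ∘ fun t : ℝ => (c, (0 : ℝ)) + t • (c, (0 : ℝ))) = fun t : ℝ => σ ((1 + t) • c, 0) := by
    funext t
    simp [add_smul]
  rwa [heq] at hcomp

/-- **Sign change along the ray from a visible derivative.**  If `σ(c, 0) = 0`, `σ` has Fréchet derivative `ℓ` at
`(c, 0)` and `ℓ(c, 0) ≠ 0`, then for every `η > 0` there are `s₁, s₂` with `|sᵢ - 1| < η` and
`σ(s₁ • c, 0) < 0 < σ(s₂ • c, 0)`. [folklore] -/
theorem exists_ray_sign_change {P : Type*} [NormedAddCommGroup P] [NormedSpace ℝ P] {σ : P × ℝ → ℝ}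
    {ℓ : P × ℝ →L[ℝ] ℝ} {c : P} (hσ0 : σ (c, 0) = 0) (hσ : HasFDerivAt σ ℓ (c, 0)) (hℓ : ℓ (c, 0) ≠ 0)
    {η : ℝ} (hη : 0 < η) :
    ∃ s₁ s₂ : ℝ, |s₁ - 1| < η ∧ |s₂ - 1| < η ∧ σ (s₁ • c, 0) < 0 ∧ 0 < σ (s₂ • c, 0) := by
  obtain ⟨t₁, t₂, ht₁, ht₂, hlt, hgt⟩ :=
    exists_sign_change_of_hasDerivAt (hasDerivAt_along_ray hσ) (by simpa using hσ0) hℓ hη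
  exact ⟨1 + t₁, 1 + t₂, by simpa using ht₁, by simpa using ht₂, hlt, hgt⟩

/-! ## §2 The registered stub -/

/-- **Registered stub `stub_radialPeriodic`** (companion c4, class R, periodic): radial visibility (`f_c + β∂ₜu` never
in the range of the linearised periodic problem along a genuinely time-dependent, simply degenerate periodic orbit `u`
of `NS_ν(f_c)`) gives a periodic Lyapunov–Schmidt function `σ : P_S × ℝ → ℝ` whose zeros near `(c, 0)` are periodic
orbits of the uncorrected forces `f_{q.1}`, uniformly `L² ∩ Ḣ¹`-near `u` after time rescaling, and which changes
sign along the ray `s ↦ σ(s • c, 0)` at `s = 1`.  Proof: the landed periodic Lyapunov–Schmidt family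
`LsFamilyPeriodic.stub_lsFamilyPeriodic` with border `H := f_c` (admissible: smooth and time independent, divergence
free, mean zero; its non-solvability hypothesis is the radial hypothesis since `cplx f_c x = realToComplex (f_c x)`);
the family-at-zeros clause is a projection of its realisation clause, and the sign change is
`exists_ray_sign_change` fed with `σ(c,0) = 0`, the Fréchet derivative `ℓ` and the visibility test `ℓ(c,0) ≠ 0`
(applied to `d := c`).  (Iooss 1972 §2–3; Henry 1981 Thm. 8.3.2; Kielhöfer 2012 §I.8.) [folklore] -/
theorem stub_radialPeriodic : ∀ (S : Finset (Fin 3 → ℤ)) (c : Coeff S) (ν τ : ℝ) (u : ℝ → UnitAddTorus (Fin 3) → EuclideanSpace ℝ (Fin 3)) (p : ℝ → UnitAddTorus (Fin 3) → ℝ) (v : ℝ → UnitAddTorus (Fin 3) → EuclideanSpace ℝ (Fin 3)), 0 < ν → 0 < τ → IsClassicalNSSolutionOn Set.univ ν (fun _ => force S c) u p → Function.Periodic u τ → (∃ t x, Torus.timeDerivWithin Set.univ u t x ≠ 0) → IsSmoothSpaceTimeOn Set.univ v → Function.Periodic v τ → (∀ t, IsDivFree (v t)) → (∀ t, HasZeroMean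 (v t)) → (¬ ∃ z : ℂ, ∀ t x, Torus.realToComplex (v t x) = z • velocityDot u t x) → (∀ (w : ℝ → UnitAddTorus (Fin 3) → EuclideanSpace ℂ (Fin 3)) (β : ℂ), w ∈ linPeriodicSol ν u τ (fun t x => β • velocityDot u t x) → ∃ z₁ z₂ : ℂ, ∀ t x, w t x = z₁ • velocityDot u t x + z₂ • Torus.realToComplex (v t x)) → (∀ β : ℂ, linPeriodicSol ν u τ (fun t x => β • velocityDot u t x + cplx (force S c) x) = ∅) → ∃ σ : Coeff S × ℝ → ℝ, (∀ δ : ℝ, 0 < δ → ∃ r : ℝ, 0 < r ∧ ContinuousOn σ (Metric.ball (c, (0 : ℝ)) r) ∧ ∀ q ∈ Metric.ball (c, (0 : ℝ)) r, σ q = 0 → ∃ (τ' : ℝ) (u' : ℝ → UnitAddTorus (Fin 3) → EuclideanSpace ℝ (Fin 3)) (p' : ℝ → UnitAddTorus (Fin 3) → ℝ), 0 < τ' ∧ IsClassicalNSSolutionOn Set.univ ν (fun _ => force S q.1) u' p' ∧ Function.Periodic u' τ' ∧ ∀ t, (∫ x, ‖u' t x - u (τ / τ' * t) x‖ ^ 2)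 + gradNormSq (fun x => u' t x - u (τ / τ' * t) x) ≤ δ) ∧ ∀ η : ℝ, 0 < η → ∃ s₁ s₂ : ℝ, |s₁ - 1| < η ∧ |s₂ - 1| < η ∧ σ (s₁ • c, 0) < 0 ∧ 0 < σ (s₂ • c, 0) := by
  intro S c ν τ u p v hν hτ hsol hper hmov hsv hperv hvdiv hv0 hdeg hker hvis
  -- the border `H := f_c` is admissible for the periodic Lyapunov–Schmidt family
  have hH : IsSmoothSpaceTimeOn Set.univ (fun _ : ℝ => force S c) :=
    Torus.isSmoothSpaceTimeOn_const (SteadyPersist.isSmooth_force' c) Set.univ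
  have hHper : Function.Periodic (fun _ : ℝ => force S c) τ := fun _ => rfl
  have hHdiv : ∀ t : ℝ, IsDivFree ((fun _ : ℝ => force S c) t) := fun _ => SteadyPersist.isDivFree_force' c
  have hH0 : ∀ t : ℝ, HasZeroMean ((fun _ : ℝ => force S c) t) := fun _ => SteadyPersist.hasZeroMean_force' c
  -- its non-solvability hypothesis is the radial hypothesis (`cplx f_c x = realToComplex (f_c x)` by `rfl`)
  have hborder : ∀ β : ℂ, linPeriodicSol ν u τ
      (fun t x => β • velocityDot u t x + Torus.realToComplex ((fun _ : ℝ => force S c) t x)) = ∅ :=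
    fun β => by simpa [cplx] using hvis β
  obtain ⟨σ, hσ0, ⟨ℓ, hσd, -, hℓ⟩, hreal⟩ :=
    LsFamilyPeriodic.stub_lsFamilyPeriodic S c ν τ u p v (fun _ => force S c) hν hτ hsol hper hmov hsv hperv
      hvdiv hv0 hdeg hker hH hHper hHdiv hH0 hborder
  -- the visibility test with `d := c`
  have hm : ℓ (c, 0) ≠ 0 := hℓ c hvis
  refine ⟨σ, fun δ hδ => ?_, fun η hη => exists_ray_sign_change hσ0 hσd hm hη⟩
  -- family at zeros: projection of the realisation clause
  obtain ⟨r, hr, hcont, hq⟩ := hreal δ hδ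
  refine ⟨r, hr, hcont, fun q hqr hσq => ?_⟩
  obtain ⟨τ', u', p', hτ', hsol', hper', -, hnear⟩ := (hq q hqr).2 hσq
  exact ⟨τ', u', p', hτ', hsol', hper', hnear⟩

end Summit.AnomalousDissipation.AnomalousDissipation.Theorems.RobustLoudUpgrade.ScalingCrossing
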